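import Summits.ValiantsHypothesis.ValiantsHypothesis.Theorems.GrenetZeonDualUnipotentThreeHalvesLongMassRankOneAcyclic
import Summits.ValiantsHypothesis.ValiantsHypothesis.Theorems.GrenetZeonDualUnipotentThreeHalvesLongMassTriangular
import Summits.ValiantsHypothesis.ValiantsHypothesis.Theorems.GrenetZeonDualUnipotentThreeHalvesHeavyTopCodimOnePattern
import Literature.LinearAlgebra.Matrix.SimultaneousTriangularization

/-!
# `GrenetZeon.DualUnipotentThreeHalves` (stmt-ValiantsHypothesis-24318), line `slow_core`, stub `stub_longMassSlowLawInv` ((c)):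
# RANK-ONE-GENERATED LINEAR NILPOTENT PENCILS ARE TRIANGULARISABLE, HENCE (c)-CHEAP (`c = 3`)

ROW for the ONE research statement (c) `SlowCore.LongMassSlowLawInv` (irreducibility-free form ✓ `LongMassSlowLawAll`): every LINEAR
(constant part `0`) affine pencil `N` over the `n²` coordinates ALL of whose coefficient matrices `[x_e] N = u_e w_eᵀ` are outer products
(rank `≤ 1`), with `N ^ H = 0`, satisfies `RelCert n m N (3·(⌊√n⌋·m))` — the conclusion of (c) with `c = 3`, `n₀ = 0`
(★ `relCert_of_rankOne_generated`).  This strictly contains the PATTERN-PENCIL row (one coordinate per position, ✓ `LongMassAcyclic`):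
here the `u_e, w_e` are arbitrary vectors.

Proof.  §1 the values are `N(x) = Σ_e x_e · u_e w_eᵀ = U · diagonal x · Wᵀ`; §2 nilpotency of the values makes `G · diagonal x` nilpotent
for the GRAM MATRIX `G e e' := w_e · u_{e'}` (`(Wᵀ U D)^{h+2} = Wᵀ (U D Wᵀ)^{h+1} U D`), hence every principal submatrix of `G` is nilpotent;
§3 ✓ `exists_levels_of_hereditarilyNilpotent` (`…LongMassRankOneAcyclic`) gives levels `ℓ` with `G e e' ≠ 0 → ℓ e < ℓ e'`; §4 the flag
`F_t := span{u_e : ℓ e < t}` (`F_t = ⊤` past the top level) is invariant with `u_{e'} w_{e'}ᵀ · F_{t+1} ⊆ F_t`, so every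
`p(V)·(V_k V_l − V_l V_k)` lowers the flag and is nilpotent — McCoy's criterion (✓ Literature
`SimultaneousTriangularization.forall_isNilpotent_iff_exists_isUnit`, Horn–Johnson Thm 2.4.8.7) yields ONE invertible `S` with every
`S⁻¹ (u_e w_eᵀ) S` upper triangular; §5 then every value `S⁻¹ N(x) S` is upper triangular and nilpotent, hence strictly upper triangular
(✓ `diag_eq_zero_of_isNilpotent_triangular`), and ✓ `TriangularRow.relCert_of_values_triangularisable` prices the pencil at `3·√n·m`.

Honest framing: a support row (`--supports stmt-ValiantsHypothesis-24318`) on a locus that never contains an `IrreducibleInv` constituent of size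
`≥ 2` (rank-one-generated nilpotent spaces have a common kernel vector); NOT progress on (c), which with S3, 24318, 8062, VP ≠ VNP stays OPEN /
NOT proved.  No sorry, no definitions, no named facts. [folklore; McCoy via the tree]
-/

-- single-conjunct layout: Sub = Summit, duplicated namespace component intended (the name is mandated)
set_option linter.dupNamespace false
set_option autoImplicit false

noncomputable section

namespace Summit.ValiantsHypothesis.ValiantsHypothesis.Theorems.GrenetZeon.LongMassRankOne

open MvPolynomial Matrix
open scoped BigOperators
open Summit.ValiantsHypothesis.ValiantsHypothesis.Cruxes.TwoDimCoefficients.DimTwoCases (AffMat IsAffine)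
open Summit.ValiantsHypothesis.ValiantsHypothesis.Theorems.GrenetZeon.SlowCore (Ledger RelCert)
open Summit.ValiantsHypothesis.ValiantsHypothesis.Theorems.GrenetZeon.FlagCost (conj_pow_eq)
open Summit.ValiantsHypothesis.ValiantsHypothesis.Theorems.GrenetZeon.TriangularRow (relCert_of_values_triangularisable)
open Summit.ValiantsHypothesis.ValiantsHypothesis.Theorems.GrenetZeon.HeavyTopCodimOnePattern (diag_eq_zero_of_isNilpotent_triangular)

variable {n m : ℕ}

/-! ## §1 Values of a linear rank-one-generated pencil -/

/-- The values of a LINEAR pencil with outer-product coefficients: `N(x) = Σ_e x_e • u_e w_eᵀ`. -/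
theorem map_eval_eq_sum_smul_vecMulVec (N : AffMat n m) (hN : IsAffine N) (h0 : ∀ i j, coeff 0 (N i j) = 0)
    (u w : Fin n × Fin n → Fin m → ℂ) (hcoef : ∀ e i j, coeff (Finsupp.single e 1) (N i j) = u e i * w e j)
    (x : Fin n × Fin n → ℂ) :
    N.map (eval x) = ∑ e, x e • vecMulVec (u e) (w e) := by
  ext i j
  rw [Matrix.map_apply, Matrix.sum_apply]
  have haff := Literature.Computability.AlgebraicComplexity.LRPencil.eq_affine_of_totalDegree_le_one (N i j) (hN i j)
  conv_lhs => rw [haff]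
  simp only [map_add, map_sum, map_mul, eval_C, eval_X, h0 i j, zero_add, Matrix.smul_apply, vecMulVec_apply, smul_eq_mul, hcoef]
  exact Finset.sum_congr rfl fun e _ => by ring

/-- The same as a matrix product `U · diagonal x · Wᵀ`. -/
theorem sum_smul_vecMulVec_eq_mul (u w : Fin n × Fin n → Fin m → ℂ) (x : Fin n × Fin n → ℂ) :
    (∑ e, x e • vecMulVec (u e) (w e)) =
      (Matrix.of fun i e => u e i) * Matrix.diagonal x * (Matrix.of fun e j => w e j) := by
  ext i j
  rw [Matrix.sum_apply, Matrix.mul_apply]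
  refine Finset.sum_congr rfl fun e _ => ?_
  rw [Matrix.mul_diagonal, Matrix.smul_apply, vecMulVec_apply, Matrix.of_apply, Matrix.of_apply, smul_eq_mul]
  ring

/-! ## §2 The Gram matrix of a nilpotent rank-one-generated pencil is hereditarily nilpotent -/

section Gram

variable {κ : Type*} [Fintype κ] [DecidableEq κ]

/-- `(A B)^{j+1} = A (B A)^j B`. -/
theorem pow_succ_mul_shape {α β : Type*} [Fintype α] [Fintype β] [DecidableEq α] [DecidableEq β]
    (A : Matrix α β ℂ) (B : Matrix β α ℂ) (j : ℕ) : (A * B) ^ (j + 1) = A * (B * A) ^ j * B := by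
  induction j with
  | zero => rw [zero_add, pow_one, pow_zero, Matrix.mul_one]
  | succ j ih =>
    rw [pow_succ, ih, pow_succ]
    simp only [Matrix.mul_assoc]

/-- `(Wᵀ U D)^{j+1} = Wᵀ (U D Wᵀ)^j U D`. -/
theorem pow_succ_WUD (U : Matrix (Fin m) κ ℂ) (D : Matrix κ κ ℂ) (Wt : Matrix κ (Fin m) ℂ) (j : ℕ) :
    (Wt * U * D) ^ (j + 1) = Wt * (U * D * Wt) ^ j * U * D := by
  induction j with
  | zero => rw [zero_add, pow_one, pow_zero, Matrix.mul_one]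
  | succ j ih =>
    rw [pow_succ, ih, pow_succ]
    simp only [Matrix.mul_assoc]

/-- Powers of a principal submatrix on an injective index map: `(G|_c)^{j+1} = (G (D_c G)^j)|_c` with `D_c` the indicator diagonal of
the range of `c`. -/
theorem submatrix_pow_succ (G : Matrix κ κ ℂ) {k : ℕ} (c : Fin k → κ) (hc : Function.Injective c) (j : ℕ) :
    (G.submatrix c c) ^ (j + 1) =
      (G * (Matrix.diagonal (fun e => if e ∈ Finset.univ.image c then (1 : ℂ) else 0) * G) ^ j).submatrix c c := by
  induction j with
  | zero => rw [zero_add, pow_one, pow_zero, Matrix.mul_one]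
  | succ j ih =>
    rw [pow_succ, ih]
    generalize hD : Matrix.diagonal (fun e => if e ∈ Finset.univ.image c then (1 : ℂ) else 0) = D
    have hR : G * (D * G) ^ (j + 1) = G * (D * G) ^ j * D * G := by
      rw [pow_succ]; simp only [Matrix.mul_assoc]
    rw [hR]
    ext a b
    rw [Matrix.mul_apply, Matrix.submatrix_apply, Matrix.mul_apply]
    simp only [Matrix.submatrix_apply]
    have h1 : ∑ l, (G * (D * G) ^ j) (c a) (c l) * G (c l) (c b) =
        ∑ e ∈ Finset.univ.image c, (G * (D * G) ^ j) (c a) e * G e (c b) := by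
      rw [Finset.sum_image (fun l _ l' _ h => hc h)]
    rw [h1, ← Finset.univ_inter (Finset.univ.image c), ← Finset.sum_ite_mem]
    refine Finset.sum_congr rfl fun e _ => ?_
    rw [← hD, Matrix.mul_diagonal]
    split_ifs with h
    · rw [mul_one]
    · rw [mul_zero, zero_mul]

/-- ★ **Hereditary nilpotency of the Gram matrix.**  If `U · diagonal x · Wᵀ` is nilpotent of bounded index for EVERY `x`, then every
principal submatrix of `G := Wᵀ U` is nilpotent. -/
theorem hereditarilyNilpotent_gram (U : Matrix (Fin m) κ ℂ) (Wt : Matrix κ (Fin m) ℂ) {h : ℕ}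
    (hnil : ∀ x : κ → ℂ, (U * Matrix.diagonal x * Wt) ^ (h + 1) = 0)
    (k : ℕ) (c : Fin k → κ) (hc : Function.Injective c) : IsNilpotent ((Wt * U).submatrix c c) := by
  refine ⟨h + 3 + 1, ?_⟩
  rw [submatrix_pow_succ _ c hc (h + 3)]
  generalize hD : Matrix.diagonal (fun e => if e ∈ Finset.univ.image c then (1 : ℂ) else 0) = D
  have hGD : (Wt * U * D) ^ (h + 2) = 0 := by
    rw [pow_succ_WUD, ← hD, hnil, Matrix.mul_zero, Matrix.zero_mul, Matrix.zero_mul]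
  have hDG : (D * (Wt * U)) ^ (h + 3) = 0 := by
    rw [pow_succ_mul_shape D (Wt * U) (h + 2), hGD, Matrix.mul_zero, Matrix.zero_mul]
  rw [hDG, Matrix.mul_zero, Matrix.submatrix_zero, Pi.zero_apply, Pi.zero_apply]

end Gram

/-! ## §3 The Gram matrix of the pencil; levels -/

/-- The GRAM MATRIX `G e e' := w_e · u_{e'}` is `Wᵀ U`. -/
theorem gram_eq (u w : Fin n × Fin n → Fin m → ℂ) :
    (Matrix.of fun e e' => w e ⬝ᵥ u e') = (Matrix.of fun e j => w e j) * (Matrix.of fun i e => u e i) := by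
  ext e e'
  rw [Matrix.of_apply, Matrix.mul_apply]
  rfl

/-- ★ **LEVELS.**  For a nilpotent linear rank-one-generated pencil, the coordinates carry levels `ℓ` with
`w_e · u_{e'} ≠ 0 → ℓ e < ℓ e'`. -/
theorem exists_levels_of_rankOne_generated (N : AffMat n m) (hN : IsAffine N) {H : ℕ} (hnil : N ^ H = 0)
    (h0 : ∀ i j, coeff 0 (N i j) = 0) (u w : Fin n × Fin n → Fin m → ℂ)
    (hcoef : ∀ e i j, coeff (Finsupp.single e 1) (N i j) = u e i * w e j) :
    ∃ ℓ : Fin n × Fin n → ℕ, ∀ e e', w e ⬝ᵥ u e' ≠ 0 → ℓ e < ℓ e' := by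
  classical
  have hval : ∀ x : Fin n × Fin n → ℂ,
      ((Matrix.of fun i e => u e i) * Matrix.diagonal x * (Matrix.of fun e j => w e j)) ^ (H + 1) = 0 := by
    intro x
    rw [← sum_smul_vecMulVec_eq_mul, ← map_eval_eq_sum_smul_vecMulVec N hN h0 u w hcoef x, ← Matrix.map_pow, pow_succ,
      hnil, Matrix.zero_mul]
    exact Matrix.map_zero _ (map_zero _)
  obtain ⟨ℓ, hℓ⟩ := exists_levels_of_hereditarilyNilpotent (Matrix.of fun e e' => w e ⬝ᵥ u e') fun k c hc => by
    rw [gram_eq]; exact hereditarilyNilpotent_gram _ _ hval k c hc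
  exact ⟨ℓ, fun e e' h => hℓ e e' h⟩

/-! ## §4 The invariant flag and McCoy's criterion -/

section Flag

variable (u w : Fin n × Fin n → Fin m → ℂ) (ℓ : Fin n × Fin n → ℕ) (L : ℕ)

/-- The FLAG `F t = span{u_e : ℓ e < t}` below the top level `L`, `F t = ⊤` above it. -/
theorem flag_mono (t : ℕ) :
    Submodule.span ℂ {v : Fin m → ℂ | (∃ e, ℓ e < t ∧ v = u e) ∨ L < t} ≤
      Submodule.span ℂ {v : Fin m → ℂ | (∃ e, ℓ e < t + 1 ∧ v = u e) ∨ L < t + 1} := by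
  apply Submodule.span_mono
  rintro v (⟨e, he, rfl⟩ | hL)
  · exact Or.inl ⟨e, by omega, rfl⟩
  · exact Or.inr (by omega)

/-- The bottom of the flag is `⊥`. -/
theorem flag_zero : Submodule.span ℂ {v : Fin m → ℂ | (∃ e, ℓ e < 0 ∧ v = u e) ∨ L < 0} = ⊥ := by
  rw [Submodule.span_eq_bot]
  rintro v (⟨e, he, -⟩ | hL)
  · exact absurd he (Nat.not_lt_zero _)
  · exact absurd hL (Nat.not_lt_zero _)

/-- The top of the flag is `⊤`. -/
theorem flag_top : Submodule.span ℂ {v : Fin m → ℂ | (∃ e, ℓ e < L + 1 ∧ v = u e) ∨ L < L + 1} = ⊤ := by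
  rw [eq_top_iff]
  intro v _
  exact Submodule.subset_span (Or.inr (Nat.lt_succ_self L))

variable {u w ℓ L}

/-- ★ **THE GENERATORS LOWER THE FLAG**: `(u_{e'} w_{e'}ᵀ) · F (t+1) ⊆ F t`. -/
theorem vecMulVec_mulVec_mem_flag (hℓ : ∀ e e', w e ⬝ᵥ u e' ≠ 0 → ℓ e < ℓ e') (hL : ∀ e, ℓ e < L)
    (e' : Fin n × Fin n) (t : ℕ) (x : Fin m → ℂ)
    (hx : x ∈ Submodule.span ℂ {v : Fin m → ℂ | (∃ e, ℓ e < t + 1 ∧ v = u e) ∨ L < t + 1}) :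
    vecMulVec (u e') (w e') *ᵥ x ∈ Submodule.span ℂ {v : Fin m → ℂ | (∃ e, ℓ e < t ∧ v = u e) ∨ L < t} := by
  induction hx using Submodule.span_induction with
  | mem v hv =>
    rw [vecMulVec_mulVec, op_smul_eq_smul]
    rcases hv with ⟨e, he, rfl⟩ | hLt
    · by_cases hz : w e' ⬝ᵥ u e = 0
      · rw [hz, zero_smul]; exact Submodule.zero_mem _
      · have := hℓ e' e hz
        exact Submodule.smul_mem _ _ (Submodule.subset_span (Or.inl ⟨e', by omega, rfl⟩))
    · have := hL e'
      exact Submodule.smul_mem _ _ (Submodule.subset_span (Or.inl ⟨e', by omega, rfl⟩))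
  | zero => rw [Matrix.mulVec_zero]; exact Submodule.zero_mem _
  | add x y _ _ hx hy => rw [Matrix.mulVec_add]; exact Submodule.add_mem _ hx hy
  | smul a x _ hx => rw [Matrix.mulVec_smul]; exact Submodule.smul_mem _ _ hx

/-- The generators PRESERVE each `F t`. -/
theorem vecMulVec_mulVec_mem_flag_self (hℓ : ∀ e e', w e ⬝ᵥ u e' ≠ 0 → ℓ e < ℓ e') (hL : ∀ e, ℓ e < L)
    (e' : Fin n × Fin n) (t : ℕ) (x : Fin m → ℂ)
    (hx : x ∈ Submodule.span ℂ {v : Fin m → ℂ | (∃ e, ℓ e < t ∧ v = u e) ∨ L < t}) :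
    vecMulVec (u e') (w e') *ᵥ x ∈ Submodule.span ℂ {v : Fin m → ℂ | (∃ e, ℓ e < t ∧ v = u e) ∨ L < t} := by
  cases t with
  | zero =>
    rw [flag_zero] at hx ⊢
    rw [(Submodule.mem_bot ℂ).mp hx, Matrix.mulVec_zero]
    exact Submodule.zero_mem _
  | succ t => exact flag_mono u ℓ L t (vecMulVec_mulVec_mem_flag hℓ hL e' t x hx)

/-- Every noncommutative polynomial in the generators PRESERVES each `F t`. -/
theorem lift_mulVec_mem_flag (hℓ : ∀ e e', w e ⬝ᵥ u e' ≠ 0 → ℓ e < ℓ e') (hL : ∀ e, ℓ e < L)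
    (p : FreeAlgebra ℂ (Fin n × Fin n)) (t : ℕ) (x : Fin m → ℂ)
    (hx : x ∈ Submodule.span ℂ {v : Fin m → ℂ | (∃ e, ℓ e < t ∧ v = u e) ∨ L < t}) :
    (FreeAlgebra.lift ℂ (fun e => vecMulVec (u e) (w e)) p) *ᵥ x ∈
      Submodule.span ℂ {v : Fin m → ℂ | (∃ e, ℓ e < t ∧ v = u e) ∨ L < t} := by
  induction p using FreeAlgebra.induction generalizing x with
  | grade0 r =>
    rw [AlgHom.commutes, Algebra.algebraMap_eq_smul_one, Matrix.smul_mulVec, Matrix.one_mulVec]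
    exact Submodule.smul_mem _ _ hx
  | grade1 e => rw [FreeAlgebra.lift_ι_apply]; exact vecMulVec_mulVec_mem_flag_self hℓ hL e t x hx
  | mul a b ha hb => rw [map_mul, ← Matrix.mulVec_mulVec]; exact ha _ (hb _ hx)
  | add a b ha hb => rw [map_add, Matrix.add_mulVec]; exact Submodule.add_mem _ (ha _ hx) (hb _ hx)

/-- ★ **McCoy's hypothesis**: every `p(V)·(V_k V_l − V_l V_k)` LOWERS the flag, hence is nilpotent. -/
theorem isNilpotent_lift_mul_commutator (hℓ : ∀ e e', w e ⬝ᵥ u e' ≠ 0 → ℓ e < ℓ e') (hL : ∀ e, ℓ e < L)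
    (p : FreeAlgebra ℂ (Fin n × Fin n)) (k l : Fin n × Fin n) :
    IsNilpotent (FreeAlgebra.lift ℂ (fun e => vecMulVec (u e) (w e)) p *
      (vecMulVec (u k) (w k) * vecMulVec (u l) (w l) - vecMulVec (u l) (w l) * vecMulVec (u k) (w k))) := by
  set X := FreeAlgebra.lift ℂ (fun e => vecMulVec (u e) (w e)) p *
      (vecMulVec (u k) (w k) * vecMulVec (u l) (w l) - vecMulVec (u l) (w l) * vecMulVec (u k) (w k)) with hX
  -- X lowers the flag by one
  have hdrop : ∀ t x, x ∈ Submodule.span ℂ {v : Fin m → ℂ | (∃ e, ℓ e < t + 1 ∧ v = u e) ∨ L < t + 1} →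
      X *ᵥ x ∈ Submodule.span ℂ {v : Fin m → ℂ | (∃ e, ℓ e < t ∧ v = u e) ∨ L < t} := by
    intro t x hx
    rw [hX, ← Matrix.mulVec_mulVec, Matrix.sub_mulVec, ← Matrix.mulVec_mulVec, ← Matrix.mulVec_mulVec]
    refine lift_mulVec_mem_flag hℓ hL p t _ (Submodule.sub_mem _ ?_ ?_)
    · exact vecMulVec_mulVec_mem_flag_self hℓ hL k t _ (vecMulVec_mulVec_mem_flag hℓ hL l t x hx)
    · exact vecMulVec_mulVec_mem_flag_self hℓ hL l t _ (vecMulVec_mulVec_mem_flag hℓ hL k t x hx)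
  -- hence X^j lowers by j
  have hpow : ∀ j t x, x ∈ Submodule.span ℂ {v : Fin m → ℂ | (∃ e, ℓ e < t + j ∧ v = u e) ∨ L < t + j} →
      (X ^ j) *ᵥ x ∈ Submodule.span ℂ {v : Fin m → ℂ | (∃ e, ℓ e < t ∧ v = u e) ∨ L < t} := by
    intro j
    induction j with
    | zero => intro t x hx; rw [pow_zero, Matrix.one_mulVec]; simpa using hx
    | succ j ih =>
      intro t x hx
      rw [pow_succ, ← Matrix.mulVec_mulVec]
      exact ih t _ (hdrop (t + j) x (by rw [show t + j + 1 = t + (j + 1) by ring]; exact hx))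
  refine ⟨L + 1, ?_⟩
  ext i j
  have hcol : (X ^ (L + 1)) *ᵥ (Pi.single j 1) = 0 := by
    have h := hpow (L + 1) 0 (Pi.single j 1) (by rw [zero_add, flag_top]; exact Submodule.mem_top)
    rw [flag_zero] at h
    exact (Submodule.mem_bot ℂ).mp h
  have := congrFun hcol i
  rw [Matrix.mulVec_single_one] at this
  exact this

/-- ★ **ONE invertible `S` triangularises all generators** (McCoy, ✓ Literature `forall_isNilpotent_iff_exists_isUnit`). -/
theorem exists_conj_blockTriangular (hℓ : ∀ e e', w e ⬝ᵥ u e' ≠ 0 → ℓ e < ℓ e') (hL : ∀ e, ℓ e < L) :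
    ∃ S : Matrix (Fin m) (Fin m) ℂ, IsUnit S ∧ ∀ e, (S⁻¹ * vecMulVec (u e) (w e) * S).BlockTriangular id :=
  (Literature.LinearAlgebra.Matrix.SimultaneousTriangularization.forall_isNilpotent_iff_exists_isUnit
    (fun e => vecMulVec (u e) (w e))).mp (fun p k l => isNilpotent_lift_mul_commutator hℓ hL p k l)

end Flag

/-! ## §5 ★ The row: rank-one-generated linear nilpotent pencils are (c)-cheap -/

/-- ★★ **RANK-ONE-GENERATED LINEAR NILPOTENT PENCILS ARE (c)-CHEAP (`c = 3`).**  A linear affine pencil (constant part `0`) over the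
`n²` coordinates, all of whose coefficient matrices are outer products `u_e w_eᵀ`, with `N ^ H = 0`, has a whole-pencil certificate of price
`≤ 3·(⌊√n⌋·m)` — the conclusion of (c) `LongMassSlowLawInv` / `LongMassSlowLawAll` with `c = 3`, `n₀ = 0`. [this file] -/
theorem relCert_of_rankOne_generated (N : AffMat n m) (hN : IsAffine N) {H : ℕ} (hnil : N ^ H = 0)
    (h0 : ∀ i j, coeff 0 (N i j) = 0) (u w : Fin n × Fin n → Fin m → ℂ)
    (hcoef : ∀ e i j, coeff (Finsupp.single e 1) (N i j) = u e i * w e j) :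
    RelCert n m N (3 * (Nat.sqrt n * m)) := by
  classical
  obtain ⟨ℓ, hℓ⟩ := exists_levels_of_rankOne_generated N hN hnil h0 u w hcoef
  set L : ℕ := Finset.univ.sup ℓ + 1 with hLdef
  have hL : ∀ e, ℓ e < L := fun e => Nat.lt_succ_of_le (Finset.le_sup (f := ℓ) (Finset.mem_univ e))
  obtain ⟨S, hS, htri⟩ := exists_conj_blockTriangular hℓ hL
  obtain ⟨uS, huS⟩ := hS
  -- P := S⁻¹ as a unit; P * A * P⁻¹ = S⁻¹ * A * S
  refine relCert_of_values_triangularisable N hN (Set.range fun x : Fin n × Fin n → ℂ => N.map (eval x))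
    (fun x => ⟨x, rfl⟩) uS⁻¹ ?_
  rintro A ⟨x, rfl⟩ i j hji
  have hP : ((uS⁻¹ : (Matrix (Fin m) (Fin m) ℂ)ˣ) : Matrix (Fin m) (Fin m) ℂ) = S⁻¹ := by rw [Matrix.coe_units_inv, huS]
  have hP' : ((uS⁻¹⁻¹ : (Matrix (Fin m) (Fin m) ℂ)ˣ) : Matrix (Fin m) (Fin m) ℂ) = S := by rw [inv_inv, huS]
  rw [hP, hP']
  -- the conjugated value is upper triangular …
  have hval : S⁻¹ * N.map (eval x) * S = ∑ e, x e • (S⁻¹ * vecMulVec (u e) (w e) * S) := by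
    rw [map_eval_eq_sum_smul_vecMulVec N hN h0 u w hcoef x, Finset.mul_sum, Finset.sum_mul]
    refine Finset.sum_congr rfl fun e _ => ?_
    rw [Matrix.mul_smul, Matrix.smul_mul]
  have hupper : ∀ a b : Fin m, b < a → (S⁻¹ * N.map (eval x) * S) a b = 0 := by
    intro a b hab
    rw [hval, Matrix.sum_apply]
    refine Finset.sum_eq_zero fun e _ => ?_
    rw [Matrix.smul_apply, htri e hab, smul_zero]
  rcases lt_or_eq_of_le hji with hlt | heq
  · exact hupper i j hlt
  · -- … and nilpotent, hence its diagonal vanishes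
    subst heq
    have hSinv : S⁻¹ * S = 1 := by rw [← huS, ← Matrix.coe_units_inv, ← Units.val_mul, inv_mul_cancel, Units.val_one]
    have hSinv' : S * S⁻¹ = 1 := by rw [← huS, ← Matrix.coe_units_inv, ← Units.val_mul, mul_inv_cancel, Units.val_one]
    have hnilx : IsNilpotent (S⁻¹ * N.map (eval x) * S) := by
      refine ⟨H, ?_⟩
      have h1 := conj_pow_eq S⁻¹ S (N.map (eval x)) hSinv' H
      rw [← Matrix.map_pow, hnil, Matrix.map_zero _ (map_zero _)] at h1
      have h3 : (S⁻¹ * N.map (eval x) * S) ^ H = (S⁻¹ * S) * (S⁻¹ * N.map (eval x) * S) ^ H * (S⁻¹ * S) := by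
        rw [hSinv, Matrix.one_mul, Matrix.mul_one]
      rw [h3, show (S⁻¹ * S) * (S⁻¹ * N.map (eval x) * S) ^ H * (S⁻¹ * S) =
        S⁻¹ * (S * (S⁻¹ * N.map (eval x) * S) ^ H * S⁻¹) * S by simp only [Matrix.mul_assoc], h1,
        Matrix.mul_zero, Matrix.zero_mul]
    refine diag_eq_zero_of_isNilpotent_triangular (fun a : Fin m => m - (a : ℕ)) (fun a b hab => Fin.ext (by
      have := a.is_lt; have := b.is_lt; beta_reduce at hab; omega)) _ (fun a b hab => hupper a b ?_) hnilx j
    have := a.is_lt; have := b.is_lt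
    beta_reduce at hab
    exact Fin.lt_def.mpr (by omega)

/-- ★ In the binder shape of the research stub (c) / `LongMassSlowLawAll`: `∀ n b B, IsAffine B → B ^ b = 0 →` (linear, rank-one-generated)
`→ RelCert n b B (3·(√n·b))`. [this file] -/
theorem longMass_on_rankOne_generated_locus :
    ∀ (n b : ℕ) (B : AffMat n b), IsAffine B → B ^ b = 0 →
      (∀ i j, coeff 0 (B i j) = 0) →
      (∃ u w : Fin n × Fin n → Fin b → ℂ, ∀ e i j, coeff (Finsupp.single e 1) (B i j) = u e i * w e j) →
      RelCert n b B (3 * (Nat.sqrt n * b)) := by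
  intro n b B hB hnil h0 ⟨u, w, hcoef⟩
  exact relCert_of_rankOne_generated B hB hnil h0 u w hcoef

end Summit.ValiantsHypothesis.ValiantsHypothesis.Theorems.GrenetZeon.LongMassRankOne

end
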